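import Mathlib.Analysis.SpecialFunctions.Pow.Real
import Literature.NumberTheory.DiophantineGeometry.Conductor
import Literature.NumberTheory.DiophantineGeometry.MinimalDiscriminant
import Literature.NumberTheory.DiophantineGeometry.LocalReduction
import HarnessLib

/-!
# Products of valuations of the minimal discriminant (Pasten's Shimura-curve bounds)

Named facts (CONVENTIONS §4, `def … : Prop`, unproved) from
H. Pasten, *Shimura curves and the abc conjecture*, J. Number Theory 254 (2024) 214–335
(= arXiv:1705.09251, held and read: introduction p. 8, §16.1 p. 49, §16.3 p. 50 of the arXiv
text), on the product `∏_{p ∣ N_E} v_p(Δ_E)` of the exponents of the minimal discriminant of an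
elliptic curve `E/ℚ` over its bad primes:

* `pasten_valuationProduct_semistable` — **Theorem 1.12** (= §16.3, "Thm 16.5" first part in
  the arXiv numbering): for semistable `E/ℚ`, `∏_{p ∣ N_E} v_p(Δ_E) < K_ε · N_E^{11/2+ε}`.
* `pasten_valuationProduct_semistable_manyPrimes` — §16.3 (arXiv "Thm 16.5", second part): if
  moreover `E` has at least `3 + 11/ε` places of bad reduction, `∏_{p ∣ N_E} v_p(Δ_E) <
  K_ε · N_E^{8/3+ε}`.
* `pasten_valuationProduct_awayFrom` — §16.1 (arXiv "Cor. 16.2", `CoroValGen`): for `E`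
  semistable away from a finite set `S` with at least two primes of multiplicative reduction,
  `∏_{p ∣ N_E^*} v_p(Δ_E) < K · N_E^{11/2+ε}`, `N_E^*` = product of the multiplicative primes —
  rendered through the conductor exponent (see the docstring) so that it is stated over the same
  vocabulary as the consumer route.

Vocabulary: `W : WeierstrassCurve ℚ` with `[W.IsElliptic]` (any model; all quantities are
isomorphism invariants), conductor `N_E = W.conductorNorm ℤ`, `v_p(Δ_E) =
(W.minimalDiscriminantNorm ℤ).factorization p` (exponent of `p` in `|Δ_min|`), semistable =
`W.IsSemistable ℤ` (tree, `LocalReduction`), real powers `Real.rpow`.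

These facts ground route `ABC/RibetTakahashiSplit`: they are the UNCONDITIONAL state of the art
for the cruxes `ManyPrimeValuationProduct` / `FewPrimeValuationProduct` (which ask for the
exponent `ε` in place of `11/2 + ε`; Pasten's Conjecture 1.14 territory) — the items are
STRONGER than print. The abc-triple version (arXiv Thm 1.10 / 16.7, exponent `8/3 + ε`) is
already in the tree as `Literature.NumberTheory.DiophantineGeometry.pasten2024_thm_2_5`
(`AbcValuationProduct.lean`) and is not repeated.

What is NOT here: Theorem 16.1/16.4 (bounds for `∏_{p ∣ D} v_p(Δ_E)` over one admissible
factorisation `N = DM`, which need the Shimura-curve/admissibility vocabulary), the Tamagawa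
versions (Thm 1.15, Cor. 16.3), Cor. 16.6 (level-lowering primes), and Conjecture 1.14 itself.
-/

noncomputable section

namespace Literature.NumberTheory.DiophantineGeometry

/-- `valuationProduct W = ∏_{p ∣ N_E} v_p(Δ_E)`: the product over the primes dividing the
conductor (= the bad primes) of the exponents of the minimal discriminant, for a Weierstrass
model `W/ℚ` (`N_E = W.conductorNorm ℤ`, `v_p(Δ_E) = (W.minimalDiscriminantNorm ℤ).factorization p`;
empty product `= 1` for `N_E = 1`). Pasten, arXiv:1705.09251, display of Theorem 1.12.
[cite: PastenShimura2024, Theorem 1.12] -/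
def valuationProduct (W : WeierstrassCurve ℚ) : ℕ :=
  ∏ p ∈ (W.conductorNorm ℤ).primeFactors, (W.minimalDiscriminantNorm ℤ).factorization p

/-- Unfolding lemma for `valuationProduct`. [folklore] -/
theorem valuationProduct_def (W : WeierstrassCurve ℚ) :
    valuationProduct W =
      ∏ p ∈ (W.conductorNorm ℤ).primeFactors, (W.minimalDiscriminantNorm ℤ).factorization p :=
  rfl

/-- **Pasten, Theorem 1.12** (Product of valuations for elliptic curves; proved in §16.3 —
"Theorem 16.5", first display, in the arXiv:1705.09251 numbering). Printed statement: "Let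
`ε > 0`. There is a number `K_ε > 0` depending only on `ε` such that for every semi-stable
elliptic curve `E` over `ℚ` we have `∏_{p ∣ N_E} v_p(Δ_E) < K_ε · N_E^{11/2+ε}`." Here `E` is any
elliptic Weierstrass model `W/ℚ` with `W.IsSemistable ℤ`, `N_E = W.conductorNorm ℤ`,
`v_p(Δ_E) = (W.minimalDiscriminantNorm ℤ).factorization p`. Unconditional state of the art for
the cruxes `Summit.ABC.ABC.Theses.RibetTakahashiSplit.ManyPrimeValuationProduct` /
`.FewPrimeValuationProduct` (which ask for exponent `ε`). [cite: PastenShimura2024, Theorem 1.12] -/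
def pasten_valuationProduct_semistable : Prop :=
  ∀ ε : ℝ, 0 < ε → ∃ K : ℝ, 0 < K ∧ ∀ (W : WeierstrassCurve ℚ) [W.IsElliptic],
    W.IsSemistable ℤ →
      (valuationProduct W : ℝ) < K * (W.conductorNorm ℤ : ℝ) ^ ((11 : ℝ) / 2 + ε)

/-- **Pasten, §16.3, second part of the semistable theorem** ("Theorem 16.5" in the
arXiv:1705.09251 numbering, second display; announced after Theorem 1.12). Printed statement:
"If moreover `ε > 0` and `E` has at least `3 + 11/ε` places of bad reduction, then we have the
stronger estimate `∏_{p ∣ N_E} v_p(Δ_E) < K_ε · N_E^{8/3+ε}`." (same `K_ε`-shape, `E/ℚ`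
semistable). The places of bad reduction of a semistable `E/ℚ` are the primes dividing `N_E`
(`(W.conductorNorm ℤ).primeFactors`). [cite: PastenShimura2024, §16.3 (arXiv Thm 16.5, second part)] -/
def pasten_valuationProduct_semistable_manyPrimes : Prop :=
  ∀ ε : ℝ, 0 < ε → ∃ K : ℝ, 0 < K ∧ ∀ (W : WeierstrassCurve ℚ) [W.IsElliptic],
    W.IsSemistable ℤ → (3 : ℝ) + 11 / ε ≤ ((W.conductorNorm ℤ).primeFactors.card : ℝ) →
      (valuationProduct W : ℝ) < K * (W.conductorNorm ℤ : ℝ) ^ ((8 : ℝ) / 3 + ε)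

/-- **Pasten, §16.1, Corollary `CoroValGen`** ("Corollary 16.2" in the arXiv:1705.09251
numbering). Printed statement: "Let `S` be a finite set of primes and let `ε > 0`. For all but
finitely many elliptic curves `E/ℚ` semi-stable away from `S` and having at least two primes of
multiplicative reduction, we have `∏_{p ∣ N_E^*} v_p(Δ_E) < N_E^{11/2+ε}` where `N_E^*` is the
product of all the primes of multiplicative reduction of `E`."
RENDERING (two routine translations, flagged for the reviewer): (i) reduction types are read off
the conductor exponent `f_p = (N_E).factorization p` — semistable at `p` iff `f_p ≤ 1` iff
`¬ p² ∣ N_E`, multiplicative at `p` iff `f_p = 1` iff `p ∣ N_E ∧ ¬ p² ∣ N_E` (Silverman ATAEC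
IV.10.2; tree: the named facts `WeierstrassCurve.conductorExponent_eq_zero_iff` /
`conductorExponent_eq_one_iff` with `factorization_conductorNorm`), exactly as the consumer route
`ABC/RibetTakahashiSplit` phrases "semistable away from 2"; (ii) "all but finitely many `E`" (up
to `ℚ`-isomorphism) is absorbed into a constant `K = K_{S,ε}`: the finitely many exceptional
classes have bounded `∏ v_p` and `N_E ≥ 1`, so `∃ K, ∀ E, ∏ < K · N_E^{11/2+ε}` follows from the
printed form (and implies it back up to Shafarevich finiteness, not claimed). With `S = {2}` this
is the unconditional counterpart (exponent `11/2 + ε` instead of `ε`, and `≥ 2` instead of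
`≥ 4` / `≤ 3` odd multiplicative primes) of the cruxes
`Summit.ABC.ABC.Theses.RibetTakahashiSplit.ManyPrimeValuationProduct` / `.FewPrimeValuationProduct`,
whose `T(E)` is the same product over `p ∥ N_E`.
[cite: PastenShimura2024, §16.1 Corollary CoroValGen (arXiv Cor. 16.2)] -/
def pasten_valuationProduct_awayFrom : Prop :=
  ∀ (S : Finset ℕ) (ε : ℝ), 0 < ε → ∃ K : ℝ, 0 < K ∧ ∀ (W : WeierstrassCurve ℚ) [W.IsElliptic],
    (∀ p : ℕ, p.Prime → p ∉ S → ¬ p ^ 2 ∣ W.conductorNorm ℤ) →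
    2 ≤ ((W.conductorNorm ℤ).primeFactors.filter (fun p => ¬ p ^ 2 ∣ W.conductorNorm ℤ)).card →
      ((∏ p ∈ (W.conductorNorm ℤ).primeFactors with ¬ p ^ 2 ∣ W.conductorNorm ℤ,
          (W.minimalDiscriminantNorm ℤ).factorization p : ℕ) : ℝ) <
        K * (W.conductorNorm ℤ : ℝ) ^ ((11 : ℝ) / 2 + ε)

/-- Sanity relation between the two products: for a conductor that is squarefree, the product
over `p ∥ N_E` is the full `valuationProduct` (every `p ∣ N_E` has `¬ p² ∣ N_E`). [folklore] -/
theorem prod_filter_eq_valuationProduct_of_squarefree (W : WeierstrassCurve ℚ)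
    (h : Squarefree (W.conductorNorm ℤ)) :
    (∏ p ∈ (W.conductorNorm ℤ).primeFactors with ¬ p ^ 2 ∣ W.conductorNorm ℤ,
        (W.minimalDiscriminantNorm ℤ).factorization p) = valuationProduct W := by
  rw [valuationProduct_def, Finset.filter_true_of_mem]
  intro p hp
  have hp' : p.Prime := Nat.prime_of_mem_primeFactors hp
  intro hsq
  have := h p (by simpa [sq] using hsq)
  exact hp'.not_isUnit (by simpa using this)

end Literature.NumberTheory.DiophantineGeometry
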